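import Summits.ResolutionOfSingularities.ResolutionOfSingularities.Theorems.MarkedTransferCampaignW46MohWindowSurfaceCubeCentre
import HarnessLib

/-!
# [OURS · L1 W4.6 rung (iii-2), `p = 2`] Surface Moh window — the CUBE NORMAL FORM of an admitted centre (cell res-hironaka,
# LADDER-RESOLUTION rung L, D-0089; seat res-L1-s46-pv-5 gen 5; host MarkedTransfer,
# `--supports stmt-ResolutionOfSingularities-16155 --as helper`; statement file `…CampaignW46MohWindowSurface.lean`)

HONEST FRAMING. Nothing here is a statement of H. Hironaka's manuscript [Hironaka2017] and nothing here asserts that any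
statement of it holds. Polynomial and local-ring algebra feeding the EXIT-BOUND FORM of the purely inseparable surface-window rung
at `p = 2` (`MohWindowSurfaceInsepFinLocalExitBound 2 K`, o1 §3): by `…CubeCentre.lean` the residue cubic of an admitted centre is
a cube at every prime; here that property is turned into a NORMAL FORM of the coefficient window presentation — after a linear
change of the regular system of parameters the cubic part is `a₃ · y³` up to terms with coefficients in `𝔪` — which is the input
of the fibre-uniqueness computation (successor file `…CentreFibre.lean`: over an admitted centre the transform has at most ONE
singular point). AI-written; AI review is weaker than expert review. No `sorry`; axioms standard.

WHAT IS PROVED (namespace `…CampaignW46.MohWindowSurface`).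
* `cube_or_const_of_cube_factor` — a nonzero cubic `Σ_{k ≤ 3} ā_k X^k` over a field that is a cube at every prime (`π^μ · G₀`,
  `π ∤ G₀`, `μ ∈ {0, 3}`) is EITHER `c · (X − t)³` (`c ≠ 0`) OR the nonzero constant `ā₀` (`ā₁ = ā₂ = ā₃ = 0`).
* `span_triple_sub_mul_eq` — `(x, y − l·x, z) = (x, y, z)` as ideals.
* `cubicForm_shear` — the binomial re-expansion `Σ a_k x^{3−k} y^k = Σ a′_k x^{3−k} (y − l x)^k` with the explicit sheared
  coefficients `a′`.
* `exists_cube_normal_form` — **CUBE NORMAL FORM**: in a local ring, a coefficient window presentation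
  `z² + Σ_{k ≤ 3} a_k x^{3−k} y^k` (a unit among the `a_k`) whose residue cubic is a cube at every prime can be rewritten, for a
  new regular system of parameters `(x′, y′, z)` (same `z`, `(x′, y′, z) = 𝔪`), as `z² + Σ a′_k x′^{3−k} y′^k` with `a′₃` a UNIT and
  `a′₀, a′₁, a′₂ ∈ 𝔪` — the SAME ring element. [ZariskiSamuel1960] [Matsumura1987]
-/

noncomputable section

set_option linter.dupNamespace false -- mandated namespace of this single-conjunct summit

open IsLocalRing Polynomial

namespace Summit.ResolutionOfSingularities.ResolutionOfSingularities.Theorems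

namespace CampaignW46

namespace MohWindowSurface

universe u

/-! ## 1. Polynomial algebra: a cubic that is a cube at every prime -/

section Poly

variable {κ : Type*} [Field κ]

/-- **A nonzero cubic that is a cube at every prime is `c · (X − t)³` or a nonzero constant.** If
`F = Σ_{k ≤ 3} C(ā k) X^k ≠ 0` and every prime `π` has `F = π^μ · G₀`, `π ∤ G₀`, `μ ∈ {0, 3}`, then either
`F = C c · (X − C t)³` with `c ≠ 0`, or `ā 1 = ā 2 = ā 3 = 0` and `ā 0 ≠ 0`. NOT a statement of the manuscript. [folklore] -/
theorem cube_or_const_of_cube_factor (a : ℕ → κ) (hne : (∑ k ∈ Finset.range (3 + 1), C (a k) * X ^ k) ≠ 0)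
    (hfac : ∀ π : κ[X], Prime π → ∃ (μ : ℕ) (G₀ : κ[X]),
      (μ = 0 ∨ μ = 3) ∧ (∑ k ∈ Finset.range (3 + 1), C (a k) * X ^ k) = π ^ μ * G₀ ∧ ¬ π ∣ G₀) :
    (∃ c t : κ, c ≠ 0 ∧ (∑ k ∈ Finset.range (3 + 1), C (a k) * X ^ k) = C c * (X - C t) ^ 3) ∨
      (a 0 ≠ 0 ∧ a 1 = 0 ∧ a 2 = 0 ∧ a 3 = 0) := by
  classical
  set F := ∑ k ∈ Finset.range (3 + 1), C (a k) * X ^ k with hFdef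
  have hc : ∀ n ≤ 3, a n = F.coeff n := fun n hn => by rw [hFdef, coeff_cubicSum a n hn]
  by_cases hu : IsUnit F
  · right
    obtain ⟨r, hr, hrF⟩ := Polynomial.isUnit_iff.mp hu
    refine ⟨?_, ?_, ?_, ?_⟩
    · rw [hc 0 (by norm_num), ← hrF, coeff_C_zero]; exact hr.ne_zero
    · rw [hc 1 (by norm_num), ← hrF, coeff_C, if_neg (by norm_num)]
    · rw [hc 2 (by norm_num), ← hrF, coeff_C, if_neg (by norm_num)]
    · rw [hc 3 (by norm_num), ← hrF, coeff_C, if_neg (by norm_num)]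
  · left
    obtain ⟨π, hπirr, hπF⟩ := WfDvdMonoid.exists_irreducible_factor hu hne
    have hπ : Prime π := hπirr.prime
    obtain ⟨μ, G₀, hμ, hFeq, hndvd⟩ := hfac π hπ
    have hπ0 : π ≠ 0 := hπ.ne_zero
    rcases hμ with rfl | rfl
    · exfalso
      rw [pow_zero, one_mul] at hFeq
      exact hndvd (hFeq ▸ hπF)
    · have hG₀0 : G₀ ≠ 0 := by rintro rfl; exact hne (by rw [hFeq, mul_zero])
      have hπdeg : 1 ≤ π.natDegree :=
        natDegree_pos_iff_degree_pos.mpr (degree_pos_of_irreducible hπirr)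
      -- degree bookkeeping: `3 · deg π + deg G₀ = deg F ≤ 3`
      have hdeg : 3 * π.natDegree + G₀.natDegree ≤ 3 := by
        have := natDegree_cubicSum_le a
        rw [← hFdef, hFeq, natDegree_mul (pow_ne_zero _ hπ0) hG₀0, natDegree_pow] at this
        exact this
      have hπ1 : π.natDegree = 1 := by omega
      have hG0 : G₀.natDegree = 0 := by omega
      obtain ⟨g, hg⟩ : ∃ g, G₀ = C g := ⟨_, eq_C_of_natDegree_eq_zero hG0⟩
      have hg0 : g ≠ 0 := by rintro rfl; exact hG₀0 (by rw [hg, map_zero])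
      obtain ⟨α, hα, β, hπeq⟩ := natDegree_eq_one.mp hπ1
      have hαt : α * (-β / α) = -β := by
        rw [mul_div_assoc']; exact mul_div_cancel_left₀ (-β) hα
      have hπeq' : π = C α * (X - C (-β / α)) := by
        rw [← hπeq, mul_sub, ← map_mul, hαt, map_neg, sub_neg_eq_add]
      refine ⟨α ^ 3 * g, -β / α, mul_ne_zero (pow_ne_zero _ hα) hg0, ?_⟩
      rw [hFeq, hg, hπeq']
      simp only [map_mul, map_pow]
      ring

end Poly

/-! ## 2. Local-ring algebra: the cube normal form -/

section Ring

variable {R : Type u} [CommRing R]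

/-- `(x, y − l·x, z) = (x, y, z)`. [folklore] -/
theorem span_triple_sub_mul_eq (x y z l : R) : Ideal.span {x, y - l * x, z} = Ideal.span {x, y, z} := by
  apply le_antisymm
  · rw [Ideal.span_le]
    intro r hr
    rcases hr with rfl | rfl | rfl
    · exact Ideal.subset_span (Set.mem_insert _ _)
    · exact Ideal.sub_mem _ (Ideal.subset_span (Set.mem_insert_of_mem _ (Set.mem_insert _ _)))
        (Ideal.mul_mem_left _ _ (Ideal.subset_span (Set.mem_insert _ _)))
    · exact Ideal.subset_span (Set.mem_insert_of_mem _ (Set.mem_insert_of_mem _ rfl))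
  · have hx : x ∈ Ideal.span {x, y - l * x, z} := Ideal.subset_span (Set.mem_insert _ _)
    have hy' : y - l * x ∈ Ideal.span {x, y - l * x, z} :=
      Ideal.subset_span (Set.mem_insert_of_mem _ (Set.mem_insert _ _))
    have hz : z ∈ Ideal.span {x, y - l * x, z} :=
      Ideal.subset_span (Set.mem_insert_of_mem _ (Set.mem_insert_of_mem _ rfl))
    have hy : y ∈ Ideal.span {x, y - l * x, z} := by
      have h := Ideal.add_mem _ hy' (Ideal.mul_mem_left _ l hx)
      rwa [sub_add_cancel] at h
    rw [Ideal.span_le]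
    intro r hr
    rcases hr with rfl | rfl | rfl
    · exact hx
    · exact hy
    · exact hz

/-- The sum `Σ_{k ≤ 3} b_k x^{3−k} y^k` of an `if`-defined coefficient sequence, expanded. [folklore] -/
theorem cubicForm_ite (b₀ b₁ b₂ b₃ x y : R) :
    ∑ k ∈ Finset.range (3 + 1),
        (if k = 0 then b₀ else if k = 1 then b₁ else if k = 2 then b₂ else b₃) * x ^ (3 - k) * y ^ k =
      b₀ * x ^ 3 + b₁ * x ^ 2 * y + b₂ * x * y ^ 2 + b₃ * y ^ 3 := by
  simp only [Finset.sum_range_succ, Finset.sum_range_zero]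
  norm_num

/-- **Shearing the cubic form**: with `y′ = y − l·x` and the sheared coefficients
`a′₀ = a₀ + a₁ l + a₂ l² + a₃ l³`, `a′₁ = a₁ + 2 a₂ l + 3 a₃ l²`, `a′₂ = a₂ + 3 a₃ l`, `a′₃ = a₃`, one has
`Σ a_k x^{3−k} y^k = Σ a′_k x^{3−k} y′^k`. [folklore] -/
theorem cubicForm_shear (a : ℕ → R) (x y l : R) :
    ∑ k ∈ Finset.range (3 + 1), a k * x ^ (3 - k) * y ^ k =
      ∑ k ∈ Finset.range (3 + 1),
        (if k = 0 then a 0 + a 1 * l + a 2 * l ^ 2 + a 3 * l ^ 3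
          else if k = 1 then a 1 + 2 * a 2 * l + 3 * a 3 * l ^ 2
          else if k = 2 then a 2 + 3 * a 3 * l else a 3) * x ^ (3 - k) * (y - l * x) ^ k := by
  rw [cubicForm_ite]
  simp only [Finset.sum_range_succ, Finset.sum_range_zero]
  norm_num
  ring

variable [IsLocalRing R]

/-- **[OURS · L1 W4.6 rung (iii-2), `p = 2`] THE CUBE NORMAL FORM OF A WINDOW PRESENTATION WHOSE RESIDUE CUBIC IS A CUBE.** In a
local ring `R` with `(x, y, z) = 𝔪`, let `Σ_{k ≤ 3} a_k x^{3−k} y^k` have a unit among its coefficients and residue cubic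
`Σ ā_k X^k` a cube at every prime (`…CubeCentre.lean`, `cube_factor_of_transform_mem`, first reading). Then there are `x′, y′`
with `(x′, y′, z) = 𝔪` and coefficients `a′` with `a′₃` a UNIT and `a′₀, a′₁, a′₂ ∈ 𝔪` such that
`Σ a_k x^{3−k} y^k = Σ a′_k x′^{3−k} y′^k` (the same element; hence the same window ideal `(z² + ·)`). Cases: a rational cube
root `t` — shear `y′ = y − l x`, `l̄ = t`; no root — the cubic is the constant `ā₀`, swap `x ↔ y`. NOT a statement of the
manuscript. [folklore] -/
theorem exists_cube_normal_form {x y z : R} (hxyz : Ideal.span {x, y, z} = maximalIdeal R) (a : ℕ → R)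
    (hunit : ∃ j ≤ 3, IsUnit (a j))
    (hfac : ∀ π₀ : (ResidueField R)[X], Prime π₀ → ∃ (μ : ℕ) (G₀ : (ResidueField R)[X]),
      (μ = 0 ∨ μ = 3) ∧ (∑ k ∈ Finset.range (3 + 1), C (residue R (a k)) * X ^ k) = π₀ ^ μ * G₀ ∧ ¬ π₀ ∣ G₀) :
    ∃ (x' y' : R) (a' : ℕ → R), Ideal.span {x', y', z} = maximalIdeal R ∧ IsUnit (a' 3) ∧
      (∀ j < 3, a' j ∈ maximalIdeal R) ∧
      ∑ k ∈ Finset.range (3 + 1), a k * x ^ (3 - k) * y ^ k = ∑ k ∈ Finset.range (3 + 1), a' k * x' ^ (3 - k) * y' ^ k := by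
  classical
  -- the residue cubic is nonzero
  have hne : (∑ k ∈ Finset.range (3 + 1), C (residue R (a k)) * X ^ k) ≠ 0 := by
    obtain ⟨j, hj, hju⟩ := hunit
    intro h
    have h1 : residue R (a j) = 0 := by
      rw [← coeff_cubicSum (fun k => residue R (a k)) j hj, h, coeff_zero]
    exact (residue_ne_zero_iff_isUnit _).mpr hju h1
  rcases cube_or_const_of_cube_factor (fun k => residue R (a k)) hne hfac with ⟨c, t, hc0, hF⟩ | ⟨h0, h1, h2, h3⟩
  · -- a rational cube root: shear
    obtain ⟨l, hl⟩ := Ideal.Quotient.mk_surjective t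
    have hlt : residue R l = t := hl
    -- the residues of the coefficients, read off `C c (X − C t)³`
    have hFexp : (∑ k ∈ Finset.range (3 + 1), C (residue R (a k)) * X ^ k) =
        C (-(c * t ^ 3)) * X ^ 0 + C (3 * c * t ^ 2) * X ^ 1 + C (-(3 * c * t)) * X ^ 2 + C c * X ^ 3 := by
      rw [hF]; simp only [map_mul, map_pow, map_neg, map_ofNat]; ring
    have hcf : ∀ n ≤ 3, residue R (a n) =
        (C (-(c * t ^ 3)) * X ^ 0 + C (3 * c * t ^ 2) * X ^ 1 + C (-(3 * c * t)) * X ^ 2 + C c * X ^ 3 : (ResidueField R)[X]).coeff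
          n := by
      intro n hn; rw [← coeff_cubicSum (fun k => residue R (a k)) n hn, hFexp]
    have ha0 : residue R (a 0) = -(c * t ^ 3) := by
      rw [hcf 0 (by norm_num)]; simp only [coeff_add, coeff_C_mul_X_pow]; norm_num
    have ha1 : residue R (a 1) = 3 * c * t ^ 2 := by
      rw [hcf 1 (by norm_num)]; simp only [coeff_add, coeff_C_mul_X_pow]; norm_num
    have ha2 : residue R (a 2) = -(3 * c * t) := by
      rw [hcf 2 (by norm_num)]; simp only [coeff_add, coeff_C_mul_X_pow]; norm_num
    have ha3 : residue R (a 3) = c := by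
      rw [hcf 3 (by norm_num)]; simp only [coeff_add, coeff_C_mul_X_pow]; norm_num
    refine ⟨x, y - l * x, fun k => if k = 0 then a 0 + a 1 * l + a 2 * l ^ 2 + a 3 * l ^ 3
        else if k = 1 then a 1 + 2 * a 2 * l + 3 * a 3 * l ^ 2 else if k = 2 then a 2 + 3 * a 3 * l else a 3,
      by rw [span_triple_sub_mul_eq, hxyz], ?_, ?_, cubicForm_shear a x y l⟩
    · simp only [show (3 : ℕ) ≠ 0 from by norm_num, show (3 : ℕ) ≠ 1 from by norm_num, show (3 : ℕ) ≠ 2 from by norm_num,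
        if_false]
      exact (residue_ne_zero_iff_isUnit _).mp (by rw [ha3]; exact hc0)
    · intro j hj
      rw [← residue_eq_zero_iff]
      interval_cases j
      · simp only [if_true, map_add, map_mul, map_pow, ha0, ha1, ha2, ha3, hlt]; ring
      · simp only [show (1 : ℕ) ≠ 0 from one_ne_zero, if_false, if_true, map_add, map_mul, map_pow, map_ofNat, ha1, ha2, ha3,
          hlt]; ring
      · simp only [show (2 : ℕ) ≠ 0 from two_ne_zero, show (2 : ℕ) ≠ 1 from by norm_num, if_false, if_true, map_add, map_mul,
          map_ofNat, ha2, ha3, hlt]; ring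
  · -- no root: the cubic is the constant `ā₀`; swap `x ↔ y`
    refine ⟨y, x, fun k => a (3 - k), by rw [← hxyz, Set.insert_comm], ?_, ?_, coeffForm_swap x y 3 a⟩
    · exact (residue_ne_zero_iff_isUnit _).mp (by simpa using h0)
    · intro j hj
      rw [← residue_eq_zero_iff]
      interval_cases j
      · simpa using h3
      · simpa using h2
      · simpa using h1

end Ring

end MohWindowSurface

end CampaignW46

end Summit.ResolutionOfSingularities.ResolutionOfSingularities.Theorems

end
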